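import Mathlib
import HarnessLib
import Literature.Analysis.FluidPDE.TypeIAncientMild
import Summits.NavierStokesRegularity.NavierStokesRegularity.Theorems.ExtremalTypeIConstantExtremalSpiralSymmetryBlowDownCalculus
import Summits.NavierStokesRegularity.NavierStokesRegularity.Theorems.ExtremalTypeIConstantExtremalSpiralSymmetryBlowDown

/-!
# Crux `ExtremalSpiralSymmetry` (stmt-NavierStokesRegularity-8215), line `registered`, towards stub 1 —
# SOME extremal pair is a blow-down of itself (Birkhoff recurrence for the blow-down relation)

Support file (theorems only, `--supports stmt-NavierStokesRegularity-8215`; no definitions, no named facts). Lead c2.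
Part B (part A: `…BlowDownCalculus.lean`).

Let `𝓔 = 𝓔(C)` be the set of fields `W ∈ A_C` (`IsTypeIAncientMild C W`) with `‖W(−1,0)‖ = C`; when `C` is the
minimal constant of nontrivial elements these are exactly the extremal pairs `(C, W)`. By `extremal_blowDown_extremal`
every `W ∈ 𝓔` has a blow-down in `𝓔`. This file runs Birkhoff's minimal-set argument for the (multivalued,
non-invertible) blow-down relation:

* `exists_selfBlowDown_of_forall_exists_blowDown` — the core: if `𝓔(C)` is nonempty and every `W ∈ 𝓔(C)` has a
  blow-down in `𝓔(C)`, then some `W ∈ 𝓔(C)` is a blow-down of ITSELF. Proof: evaluate fields on a dense sequence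
  `q` of the slab (`ι W = (W(q n))_n ∈ (ℝ³)^ℕ`); `S = ι(𝓔)` is compact (KNSS sequential compactness + the product
  topology is sequential); among the nonempty closed subsets of `S` invariant under the blow-down relation take a
  minimal one `F` (Zorn; chains have nonempty intersection by compactness); for `ι W ∈ F` the set `G = ι(blow-downs
  of W in 𝓔)` is nonempty, closed (`blowDown_of_tendsto`), invariant (`blowDown_trans`) and `⊆ F`, so `G = F ∋ ι W`,
  i.e. some blow-down of `W` has the values of `W` on `q`, hence equals `W` on the slab
  (`eqOn_slab_of_eq_on_dense_seq`).
* `exists_selfRecurrent_extremal` — consequently, if some extremal pair `(C, u)` exists, then there is an extremal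
  pair `(C, W)` and scales `λ_j → ∞`, centres `x_j` with `λ_j W(λ_j² t, x_j + λ_j x) → W(t, x)` for all `t < 0`, `x`:
  an extremal RECURRENT under the scaling semigroup modulo translations. This is the soft half of the route's
  Conjecture M; the missing half is ISOLATEDNESS of extremals modulo symmetries (in the topology of pointwise/locally
  uniform convergence), which would turn the approximate periods `λ_j` into an exact one (stub 1 for this `W`), whence
  the route target via the RDSS wall stmt-8561 (`typeIAncientLiouville_of_scalingRecurrence_of_rdssLiouvilleInClass`
  needs only ONE periodic extremal in its proof).
-/

noncomputable section

-- the summit and its single sub-problem share the name (CONVENTIONS §1), as in every Theorems file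
set_option linter.dupNamespace false

open Set MeasureTheory Filter Topology Function
open Literature.Analysis.FluidPDE

namespace Summit.NavierStokesRegularity.NavierStokesRegularity.Theorems.ExtremalSpiralSymmetry.Registered

/-- **Birkhoff recurrence for blow-downs (core).** If the set `𝓔(C) = {W ∈ A_C : ‖W(−1,0)‖ = C}` is nonempty and
every element has a blow-down in `𝓔(C)`, then some `W ∈ 𝓔(C)` is a blow-down of itself:
`λ_j W(λ_j² t, x_j + λ_j x) → W(t,x)` on the slab for some `λ_j → ∞`, `x_j`. (Minimal closed invariant subset of the
compact `ι(𝓔) ⊆ (ℝ³)^ℕ`; see the module docstring.) [folklore] -/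
theorem exists_selfBlowDown_of_forall_exists_blowDown {C : ℝ}
    (hne : ∃ W : ℝ → EuclideanSpace ℝ (Fin 3) → EuclideanSpace ℝ (Fin 3),
      IsTypeIAncientMild C W ∧ ‖W (-1) 0‖ = C)
    (hbd : ∀ W : ℝ → EuclideanSpace ℝ (Fin 3) → EuclideanSpace ℝ (Fin 3),
      IsTypeIAncientMild C W → ‖W (-1) 0‖ = C →
      ∃ W' : ℝ → EuclideanSpace ℝ (Fin 3) → EuclideanSpace ℝ (Fin 3),
        IsTypeIAncientMild C W' ∧ ‖W' (-1) 0‖ = C ∧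
        ∃ (lam : ℕ → ℝ) (xs : ℕ → EuclideanSpace ℝ (Fin 3)), (∀ j, 0 < lam j) ∧ Tendsto lam atTop atTop ∧
          ∀ t < (0 : ℝ), ∀ x, Tendsto (fun j => lam j • W (lam j ^ 2 * t) (xs j + lam j • x)) atTop
            (𝓝 (W' t x))) :
    ∃ W : ℝ → EuclideanSpace ℝ (Fin 3) → EuclideanSpace ℝ (Fin 3),
      IsTypeIAncientMild C W ∧ ‖W (-1) 0‖ = C ∧
      ∃ (lam : ℕ → ℝ) (xs : ℕ → EuclideanSpace ℝ (Fin 3)), (∀ j, 0 < lam j) ∧ Tendsto lam atTop atTop ∧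
        ∀ t < (0 : ℝ), ∀ x, Tendsto (fun j => lam j • W (lam j ^ 2 * t) (xs j + lam j • x)) atTop
          (𝓝 (W t x)) := by
  obtain ⟨q, hq, hqd⟩ := exists_dense_seq_slab
  -- the set `𝓔`, the evaluation map `ι` and its image `S`
  set E : Set (ℝ → EuclideanSpace ℝ (Fin 3) → EuclideanSpace ℝ (Fin 3)) :=
    {W | IsTypeIAncientMild C W ∧ ‖W (-1) 0‖ = C} with hE
  set ι : (ℝ → EuclideanSpace ℝ (Fin 3) → EuclideanSpace ℝ (Fin 3)) → (ℕ → EuclideanSpace ℝ (Fin 3)) :=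
    fun W n => W (q n).1 (q n).2 with hι
  set S : Set (ℕ → EuclideanSpace ℝ (Fin 3)) := ι '' E with hS
  -- the blow-down relation, as a predicate
  set BD : (ℝ → EuclideanSpace ℝ (Fin 3) → EuclideanSpace ℝ (Fin 3)) →
      (ℝ → EuclideanSpace ℝ (Fin 3) → EuclideanSpace ℝ (Fin 3)) → Prop :=
    fun W W' => ∃ (lam : ℕ → ℝ) (xs : ℕ → EuclideanSpace ℝ (Fin 3)), (∀ j, 0 < lam j) ∧
      Tendsto lam atTop atTop ∧
      ∀ t < (0 : ℝ), ∀ x, Tendsto (fun j => lam j • W (lam j ^ 2 * t) (xs j + lam j • x)) atTop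
        (𝓝 (W' t x)) with hBD
  -- (1) sequential compactness of `E` (KNSS) with the normalisation preserved
  have hextract : ∀ Wi : ℕ → ℝ → EuclideanSpace ℝ (Fin 3) → EuclideanSpace ℝ (Fin 3), (∀ i, Wi i ∈ E) →
      ∃ φ : ℕ → ℕ, StrictMono φ ∧ ∃ V ∈ E,
        ∀ t < (0 : ℝ), ∀ x, Tendsto (fun i => Wi (φ i) t x) atTop (𝓝 (V t x)) := by
    intro Wi hWi
    obtain ⟨φ, hφ, V, hV, hpt, -, -, -⟩ :=
      Summit.NavierStokesRegularity.NavierStokesRegularity.Theorems.exists_tendsto_of_isTypeIAncientMild_seq C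
        (fun i => (hWi i).1)
    refine ⟨φ, hφ, V, ⟨hV, ?_⟩, hpt⟩
    have h1 := (hpt (-1) (by norm_num) 0).norm
    have h2 : Tendsto (fun i => ‖Wi (φ i) (-1) 0‖) atTop (𝓝 C) := by
      have e : (fun i => ‖Wi (φ i) (-1) 0‖) = fun _ => C := funext fun i => (hWi (φ i)).2
      rw [e]
      exact tendsto_const_nhds
    exact tendsto_nhds_unique h1 h2
  -- (2) pointwise convergence on the slab gives convergence of the evaluations
  have hιtend : ∀ (Wi : ℕ → ℝ → EuclideanSpace ℝ (Fin 3) → EuclideanSpace ℝ (Fin 3))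
      (V : ℝ → EuclideanSpace ℝ (Fin 3) → EuclideanSpace ℝ (Fin 3)),
      (∀ t < (0 : ℝ), ∀ x, Tendsto (fun i => Wi i t x) atTop (𝓝 (V t x))) →
      Tendsto (fun i => ι (Wi i)) atTop (𝓝 (ι V)) := fun Wi V h =>
    tendsto_pi_nhds.2 fun n => h (q n).1 (hq n) (q n).2
  -- (3) `S` is compact
  have hSseq : IsSeqCompact S := by
    intro y hy
    choose Wi hWiE hWiy using hy
    obtain ⟨φ, hφ, V, hVE, hpt⟩ := hextract Wi hWiE
    refine ⟨ι V, ⟨V, hVE, rfl⟩, φ, hφ, ?_⟩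
    have h := hιtend (fun i => Wi (φ i)) V hpt
    have e : (fun i => ι (Wi (φ i))) = y ∘ φ := funext fun i => hWiy (φ i)
    rwa [e] at h
  have hScpt : IsCompact S := hSseq.isCompact
  -- (4) the admissible family: nonempty closed subsets of `S` invariant under blow-downs
  set A : Set (Set (ℕ → EuclideanSpace ℝ (Fin 3))) :=
    {F | F ⊆ S ∧ F.Nonempty ∧ IsClosed F ∧ ∀ W ∈ E, ι W ∈ F → ∀ W' ∈ E, BD W W' → ι W' ∈ F} with hA
  obtain ⟨W₀, hW₀⟩ := hne
  have hSA : S ∈ A :=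
    ⟨subset_rfl, ⟨ι W₀, W₀, hW₀, rfl⟩, hScpt.isClosed, fun W _ _ W' hW' _ => ⟨W', hW', rfl⟩⟩
  have hchain : ∀ c ⊆ A, IsChain (· ⊆ ·) c → ∃ lb ∈ A, ∀ s ∈ c, lb ⊆ s := by
    intro c hcA hc
    rcases c.eq_empty_or_nonempty with rfl | hcne
    · exact ⟨S, hSA, by simp⟩
    refine ⟨⋂₀ c, ⟨?_, ?_, ?_, ?_⟩, fun s hs => sInter_subset_of_mem hs⟩
    · obtain ⟨s, hs⟩ := hcne
      exact (sInter_subset_of_mem hs).trans (hcA hs).1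
    · haveI : Nonempty c := hcne.to_subtype
      have hdir : DirectedOn (· ⊇ ·) c := by
        intro a ha b hb
        rcases hc.total ha hb with hab | hba
        · exact ⟨a, ha, subset_rfl, hab⟩
        · exact ⟨b, hb, hba, subset_rfl⟩
      exact IsCompact.nonempty_sInter_of_directed_nonempty_isCompact_isClosed hdir
        (fun s hs => (hcA hs).2.1) (fun s hs => hScpt.of_isClosed_subset (hcA hs).2.2.1 (hcA hs).1)
        (fun s hs => (hcA hs).2.2.1)
    · exact isClosed_sInter fun s hs => (hcA hs).2.2.1
    · intro W hW hWF W' hW' hbd'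
      rw [mem_sInter] at hWF ⊢
      exact fun s hs => (hcA hs).2.2.2 W hW (hWF s hs) W' hW' hbd'
  -- (5) a minimal admissible set
  obtain ⟨F, hFmin⟩ := zorn_superset A hchain
  have hF : F ∈ A := hFmin.prop
  obtain ⟨y, hy⟩ := hF.2.1
  obtain ⟨W, hWE, hWy⟩ := hF.1 hy
  -- the blow-downs of `W` inside `E`
  set G : Set (ℕ → EuclideanSpace ℝ (Fin 3)) := ι '' {W' | W' ∈ E ∧ BD W W'} with hG
  have hGF : G ⊆ F := by
    rintro _ ⟨W', ⟨hW'E, hbd'⟩, rfl⟩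
    exact hF.2.2.2 W hWE (hWy ▸ hy) W' hW'E hbd'
  have hGne : G.Nonempty := by
    obtain ⟨W', hW'A, hW'n, hbd'⟩ := hbd W hWE.1 hWE.2
    exact ⟨ι W', W', ⟨⟨hW'A, hW'n⟩, hbd'⟩, rfl⟩
  have hGclosed : IsClosed G := by
    refine IsSeqClosed.isClosed fun z p hz hzp => ?_
    choose Wi hWi hWiz using hz
    obtain ⟨φ, hφ, V, hVE, hpt⟩ := hextract Wi (fun i => (hWi i).1)
    have hιV : Tendsto (fun i => ι (Wi (φ i))) atTop (𝓝 (ι V)) := hιtend _ _ hpt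
    have hzφ : Tendsto (fun i => z (φ i)) atTop (𝓝 p) := hzp.comp hφ.tendsto_atTop
    have e : (fun i => ι (Wi (φ i))) = fun i => z (φ i) := funext fun i => hWiz (φ i)
    rw [e] at hιV
    have hp : p = ι V := tendsto_nhds_unique hzφ hιV
    refine ⟨V, ⟨hVE, ?_⟩, hp.symm⟩
    exact blowDown_of_tendsto hWE.1 (W' := fun i => Wi (φ i)) (fun i => (hWi (φ i)).2) hVE.1 hpt
  have hGinv : ∀ W₁ ∈ E, ι W₁ ∈ G → ∀ W₂ ∈ E, BD W₁ W₂ → ι W₂ ∈ G := by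
    rintro W₁ hW₁ ⟨W₃, ⟨hW₃E, hbd₃⟩, hW₃₁⟩ W₂ hW₂ hbd₁₂
    have heq : ∀ t < (0 : ℝ), ∀ x, W₃ t x = W₁ t x :=
      eqOn_slab_of_eq_on_dense_seq hq hqd hW₃E.1 hW₁.1 (fun n => congr_fun hW₃₁ n)
    have hbdW₁ : BD W W₁ := by
      obtain ⟨lam, xs, hp, ht, hc⟩ := hbd₃
      exact ⟨lam, xs, hp, ht, fun t ht' x => (heq t ht' x) ▸ hc t ht' x⟩
    exact ⟨W₂, ⟨hW₂, blowDown_trans hWE.1 hW₂.1 hbdW₁ hbd₁₂⟩, rfl⟩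
  have hGA : G ∈ A := ⟨hGF.trans hF.1, hGne, hGclosed, hGinv⟩
  have hGeq : G = F := Subset.antisymm hGF (hFmin.2 hGA hGF)
  -- hence `ι W ∈ G`: some blow-down of `W` takes the values of `W` on `q`, so equals `W` on the slab
  have hWG : ι W ∈ G := by rw [hGeq, hWy]; exact hy
  obtain ⟨W', ⟨hW'E, hbdW'⟩, hW'W⟩ := hWG
  have heq' : ∀ t < (0 : ℝ), ∀ x, W' t x = W t x :=
    eqOn_slab_of_eq_on_dense_seq hq hqd hW'E.1 hWE.1 (fun n => congr_fun hW'W n)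
  obtain ⟨lam, xs, hp, ht, hc⟩ := hbdW'
  exact ⟨W, hWE.1, hWE.2, lam, xs, hp, ht, fun t ht' x => (heq' t ht' x) ▸ hc t ht' x⟩

/-- **A recurrent extremal pair.** If some extremal pair `(C, u)` exists (`u ∈ A_C` written out, `‖u(−1,0)‖ = C > 0`,
`C` minimal among the constants of nontrivial elements), then there is an extremal pair `(C, W)` RECURRENT under the
scaling semigroup modulo translations: `λ_j W(λ_j² t, x_j + λ_j x) → W(t, x)` for all `t < 0`, `x`, along some
`λ_j → ∞`, `x_j`. (Every extremal has an extremal blow-down, `extremal_blowDown_extremal`; Birkhoff recurrence for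
the blow-down relation, `exists_selfBlowDown_of_forall_exists_blowDown`.) The soft half of Conjecture M: were
extremals ISOLATED modulo symmetries, the approximate periods `λ_j` of `W` would be exact and `W` would be RDSS.
[folklore] -/
theorem exists_selfRecurrent_extremal :
    (∃ (C : ℝ) (u : ℝ → EuclideanSpace ℝ (Fin 3) → EuclideanSpace ℝ (Fin 3)), 0 < C ∧
      (ContDiffOn ℝ (⊤ : ℕ∞) (Function.uncurry u) (Set.Iio 0 ×ˢ Set.univ) ∧
          (∀ t < 0, Literature.Analysis.FluidPDE.VectorCalculus.IsDivFree (u t)) ∧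
          (∀ s t : ℝ, s < t → t < 0 → ∀ x, u t x =
            Literature.Analysis.FluidPDE.heatFlow (u s) (t - s) x -
              ∫ τ in Set.Ioo s t, ∫ y,
                Literature.Analysis.FluidPDE.oseenKernel (t - τ) (x - y) (u τ y) (u τ y)) ∧
          Literature.Analysis.FluidPDE.HasTypeITimeDecay C u) ∧
        ‖u (-1) 0‖ = C ∧
        (∀ (C' : ℝ) (u' : ℝ → EuclideanSpace ℝ (Fin 3) → EuclideanSpace ℝ (Fin 3)),
          (ContDiffOn ℝ (⊤ : ℕ∞) (Function.uncurry u') (Set.Iio 0 ×ˢ Set.univ) ∧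
            (∀ t < 0, Literature.Analysis.FluidPDE.VectorCalculus.IsDivFree (u' t)) ∧
            (∀ s t : ℝ, s < t → t < 0 → ∀ x, u' t x =
              Literature.Analysis.FluidPDE.heatFlow (u' s) (t - s) x -
                ∫ τ in Set.Ioo s t, ∫ y,
                  Literature.Analysis.FluidPDE.oseenKernel (t - τ) (x - y) (u' τ y) (u' τ y)) ∧
            Literature.Analysis.FluidPDE.HasTypeITimeDecay C' u') →
          (∃ t < 0, ∃ x, u' t x ≠ 0) → C ≤ C')) →
    ∃ (C : ℝ) (W : ℝ → EuclideanSpace ℝ (Fin 3) → EuclideanSpace ℝ (Fin 3)), 0 < C ∧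
      ((ContDiffOn ℝ (⊤ : ℕ∞) (Function.uncurry W) (Set.Iio 0 ×ˢ Set.univ) ∧
          (∀ t < 0, Literature.Analysis.FluidPDE.VectorCalculus.IsDivFree (W t)) ∧
          (∀ s t : ℝ, s < t → t < 0 → ∀ x, W t x =
            Literature.Analysis.FluidPDE.heatFlow (W s) (t - s) x -
              ∫ τ in Set.Ioo s t, ∫ y,
                Literature.Analysis.FluidPDE.oseenKernel (t - τ) (x - y) (W τ y) (W τ y)) ∧
          Literature.Analysis.FluidPDE.HasTypeITimeDecay C W) ∧
        ‖W (-1) 0‖ = C ∧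
        (∀ (C' : ℝ) (u' : ℝ → EuclideanSpace ℝ (Fin 3) → EuclideanSpace ℝ (Fin 3)),
          (ContDiffOn ℝ (⊤ : ℕ∞) (Function.uncurry u') (Set.Iio 0 ×ˢ Set.univ) ∧
            (∀ t < 0, Literature.Analysis.FluidPDE.VectorCalculus.IsDivFree (u' t)) ∧
            (∀ s t : ℝ, s < t → t < 0 → ∀ x, u' t x =
              Literature.Analysis.FluidPDE.heatFlow (u' s) (t - s) x -
                ∫ τ in Set.Ioo s t, ∫ y,
                  Literature.Analysis.FluidPDE.oseenKernel (t - τ) (x - y) (u' τ y) (u' τ y)) ∧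
            Literature.Analysis.FluidPDE.HasTypeITimeDecay C' u') →
          (∃ t < 0, ∃ x, u' t x ≠ 0) → C ≤ C')) ∧
      ∃ (lam : ℕ → ℝ) (xs : ℕ → EuclideanSpace ℝ (Fin 3)), (∀ j, 0 < lam j) ∧ Tendsto lam atTop atTop ∧
        ∀ t < (0 : ℝ), ∀ x, Tendsto (fun j => lam j • W (lam j ^ 2 * t) (xs j + lam j • x)) atTop
          (𝓝 (W t x)) := by
  rintro ⟨C, u, hC, hcls, hnorm, hmin⟩
  have hA : IsTypeIAncientMild C u := isTypeIAncientMild_iff.2 hcls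
  -- every element of `𝓔(C)` is an extremal pair (minimality is a property of `C`), so it has an extremal blow-down
  have hbd : ∀ W : ℝ → EuclideanSpace ℝ (Fin 3) → EuclideanSpace ℝ (Fin 3),
      IsTypeIAncientMild C W → ‖W (-1) 0‖ = C →
      ∃ W' : ℝ → EuclideanSpace ℝ (Fin 3) → EuclideanSpace ℝ (Fin 3),
        IsTypeIAncientMild C W' ∧ ‖W' (-1) 0‖ = C ∧
        ∃ (lam : ℕ → ℝ) (xs : ℕ → EuclideanSpace ℝ (Fin 3)), (∀ j, 0 < lam j) ∧ Tendsto lam atTop atTop ∧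
          ∀ t < (0 : ℝ), ∀ x, Tendsto (fun j => lam j • W (lam j ^ 2 * t) (xs j + lam j • x)) atTop
            (𝓝 (W' t x)) := by
    intro W hW hWn
    obtain ⟨lam, xs, W', hpos, htop, hconv, hW'cls, hW'n, -⟩ :=
      extremal_blowDown_extremal C W hC ⟨isTypeIAncientMild_iff.1 hW, hWn, hmin⟩
    exact ⟨W', isTypeIAncientMild_iff.2 hW'cls, hW'n, lam, xs, hpos, htop, hconv⟩
  obtain ⟨W, hW, hWn, hrec⟩ := exists_selfBlowDown_of_forall_exists_blowDown ⟨u, hA, hnorm⟩ hbd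
  exact ⟨C, W, hC, ⟨isTypeIAncientMild_iff.1 hW, hWn, hmin⟩, hrec⟩

end Summit.NavierStokesRegularity.NavierStokesRegularity.Theorems.ExtremalSpiralSymmetry.Registered

end
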